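import Summits.SmoothPoincare4.SmoothPoincare4.Theorems.CylinderEntropyCylinderRungTwoStaticMonotonicityIdentity
import Summits.SmoothPoincare4.SmoothPoincare4.Theorems.CylinderEntropyCylinderRungTwoVerticalTestIdentity
import Summits.SmoothPoincare4.SmoothPoincare4.Theorems.CylinderEntropyCylinderRungTwoProductTestIdentity
import HarnessLib

/-!
# Route `CylinderEntropy`, item `ImmortalAreaToFloor` (stmt-SmoothPoincare4-17197):
# the HEIGHT-WEIGHTED static Gaussian monotonicity identity (module Γ2 of `BLUEPRINT-17197-c2.md`)

For a closed immersed cross-section `f : M⁴ → N = S⁴ × ℝ ⊂ ℝ⁶` with smooth unit normal `ν` tangent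
to `N`, mean curvature `H` of `(f, ν)`, radial normal `n = (z', 0) ∘ f`, `S = |ν'|²`, the Gaussian
weight `G(z) = exp(-|z - x₀|²/(4τ))/(4πτ)²` (`x₀ ∈ ℝ⁶`, `τ > 0`), `r = f(w) - x₀`, and ANY height
weight `u ∈ C²(ℝ)` (evaluated at the height `z₅ = f(w)₅`):
  `∫_M ( u(z₅) G [ |r^T|²/(4τ²) - 2/τ + ((4 - S)⟨r,n⟩ + H⟨r,ν⟩)/(2τ) ]`
  `      + G (u''(z₅) (1 - ν₅²) - H u'(z₅) ν₅) - (u'(z₅) G / τ) (r₅ - ν₅ ⟨r,ν⟩) ) dμ_g = 0`,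
`|r^T|² = |r|² - ⟨r,n⟩² - ⟨r,ν⟩²`.  This is Green's identity `∫_M Δ_g((u ∘ e₅^*) · G) ∘ f) dμ_g = 0`
(landed `integral_sliceLaplacian_eq_zero`) for the PRODUCT test function `φ = u(z₅) G(z)`, expanded by
the Leibniz rules (`iteratedFDeriv_two_mul_apply`, `fderiv_mul_apply_of_differentiable`), the calculus
of `G` (`helper_gaussianWeight_*`) and of the vertical test function (`*_verticalTest*`), and
`n₅ = 0`.  For `u ≡ 1` it is the landed `staticMonotonicity_identity`; for `u` a height cutoff it is
the first variation of area along the CUT-OFF radial Gaussian field — the engine of the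
"monotonicity for a height-cut piece" in the stacking argument (Allard 1972 §6.1–6.2 / Simon 1983
§17 with a cutoff in place of a boundary term): the only price of the cutoff are the two explicit
terms carrying `u'` and `u''`, both supported in the transition slab of `u`.

* `weightedStaticMonotonicity_identity` — the identity (implicit binders).

Everything here is PROVED (no `sorry`, no new definitions, no named facts).

References: W. K. Allard, Ann. of Math. 95 (1972) §6; L. Simon, *Lectures on GMT* (1983) §17;
T. H. Colding, W. P. Minicozzi II, Ann. of Math. 175 (2012) §3; K. Ecker, *Regularity Theory for
Mean Curvature Flow* (2004), Prop. 3.16 (localised monotonicity with a cutoff).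
-/

-- the prescribed namespace `Summit.SmoothPoincare4.SmoothPoincare4.…` repeats `SmoothPoincare4`
set_option linter.dupNamespace false

noncomputable section

open Bundle Set Function Filter MeasureTheory Module
open scoped Manifold ContDiff Topology RealInnerProductSpace BigOperators

namespace Summit.SmoothPoincare4.SmoothPoincare4.Cruxes.CylinderRungTwo.KillingFlux

open Literature.Geometry.Riemannian Literature.Geometry.Riemannian.EuclideanHypersurface
open Literature.Geometry.Lorentzian Literature.Geometry.Lorentzian.PseudoRiemannianMetric
open Literature.Geometry.Riemannian.SphericalCylinderEntropy (truncL truncL_apply)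
open Literature.Geometry.Manifold.CylinderSlice (padL padL_apply_castSucc padL_apply_last)

section Identity

variable {M : Type*} [TopologicalSpace M] [ChartedSpace (EuclideanSpace ℝ (Fin 4)) M]
  [IsManifold (𝓡 4) ∞ M] [CompactSpace M] [T2Space M] [MeasurableSpace M] [BorelSpace M]

/-- **The height-weighted static Gaussian monotonicity identity.**  For a closed immersed
cross-section `f : M⁴ → N = S⁴ × ℝ ⊂ ℝ⁶` with smooth unit normal `ν` tangent to `N`, mean curvature
`H` of `(f, ν)`, radial normal `n = (z', 0) ∘ f`, `S = |ν'|²`, Gaussian weight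
`G(z) = exp(-|z - x₀|²/(4τ))/(4πτ)²` (`τ > 0`), `r = f(w) - x₀`, and a height weight `u ∈ C²(ℝ)`:
`∫_M ( u(z₅) G [ (|r|² - ⟨r,n⟩² - ⟨r,ν⟩²)/(4τ²) - 2/τ + ((4 - S)⟨r,n⟩ + H⟨r,ν⟩)/(2τ) ]`
`     + G (u''(z₅)(1 - ν₅²) - H u'(z₅) ν₅) - (u'(z₅) G/τ)(r₅ - ν₅⟨r,ν⟩) ) dμ_g = 0`.
Green's identity for `φ = u(z₅) G` (`integral_sliceLaplacian_eq_zero`), Leibniz rules, the calculus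
of `G` and of `z ↦ u(z₅)`, `n₅ = 0`, `|n| = |ν| = 1`. [cite: Allard1972, §6] -/
theorem weightedStaticMonotonicity_identity {f νf : M → EuclideanSpace ℝ (Fin 6)}
    (hf : (euclideanMetric (EuclideanSpace ℝ (Fin 6))).IsSpacelikeImmersion (𝓡 4) f)
    (hν : ContMDiff (𝓡 4) 𝓘(ℝ, EuclideanSpace ℝ (Fin 6)) ∞ νf)
    (hun : (euclideanMetric (EuclideanSpace ℝ (Fin 6))).IsUnitNormal (𝓡 4) f νf 1)
    (hN : ∀ x, ∑ i : Fin 5, f x (Fin.castSucc i) ^ 2 = 1)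
    (hνN : ∀ x, ∑ i : Fin 5, νf x (Fin.castSucc i) * f x (Fin.castSucc i) = 0)
    (x₀ : EuclideanSpace ℝ (Fin 6)) {τ : ℝ} (hτ : 0 < τ) {u : ℝ → ℝ} (hu : ContDiff ℝ 2 u) :
    ∫ w, (u (f w 5) * (Real.exp (-‖f w - x₀‖ ^ 2 / (4 * τ)) / (4 * Real.pi * τ) ^ 2) *
          ((‖f w - x₀‖ ^ 2 - ⟪f w - x₀, padL (truncL (f w))⟫ ^ 2 - ⟪f w - x₀, νf w⟫ ^ 2) / (4 * τ ^ 2)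
            - 2 / τ
            + ((4 - ∑ i : Fin 5, νf w (Fin.castSucc i) ^ 2) * ⟪f w - x₀, padL (truncL (f w))⟫
              + (euclideanMetric (EuclideanSpace ℝ (Fin 6))).meanCurvature f contMDiff_pullbackBilin_holds
                  hf νf w * ⟪f w - x₀, νf w⟫) / (2 * τ))
        + (Real.exp (-‖f w - x₀‖ ^ 2 / (4 * τ)) / (4 * Real.pi * τ) ^ 2) *
          (deriv (deriv u) (f w 5) * (1 - νf w 5 ^ 2)
            - (euclideanMetric (EuclideanSpace ℝ (Fin 6))).meanCurvature f contMDiff_pullbackBilin_holds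
                hf νf w * (deriv u (f w 5) * νf w 5))
        - (deriv u (f w 5) * (Real.exp (-‖f w - x₀‖ ^ 2 / (4 * τ)) / (4 * Real.pi * τ) ^ 2) / τ) *
          ((f w - x₀) 5 - νf w 5 * ⟪f w - x₀, νf w⟫))
      ∂riemannianMeasure ((euclideanMetric (EuclideanSpace ℝ (Fin 6))).inducedRiemannianMetric f
        contMDiff_pullbackBilin_holds hf) = 0 := by
  -- the two factors and their calculus
  set G : EuclideanSpace ℝ (Fin 6) → ℝ := fun z =>
    Real.exp (-‖z - x₀‖ ^ 2 / (4 * τ)) / (4 * Real.pi * τ) ^ 2 with hGdef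
  set U : EuclideanSpace ℝ (Fin 6) → ℝ := fun z => u (z 5) with hUdef
  have hG2 : ContDiff ℝ 2 G := helper_gaussianWeight_contDiff x₀ τ hτ
  have hU2 : ContDiff ℝ 2 U := contDiff_verticalTest hu
  have hG1 : Differentiable ℝ G := hG2.differentiable two_ne_zero
  have hU1 : Differentiable ℝ U := hU2.differentiable two_ne_zero
  have hud : Differentiable ℝ u := hu.differentiable two_ne_zero
  have hφ : ContDiff ℝ 2 (fun z => U z * G z) := hU2.mul hG2
  -- Green's identity for the product test function
  have h0 := integral_sliceLaplacian_eq_zero hf hν hun hN hνN hφ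
  -- `|ν| = 1`, `|n| = 1`, `n₅ = 0`
  have hνunit : ∀ w, ‖νf w‖ = 1 := fun w => by
    have h : ⟪νf w, νf w⟫ = (1 : ℝ) := by
      have := hun.val_self w
      rwa [euclideanMetric_apply] at this
    rw [real_inner_self_eq_norm_sq] at h
    nlinarith [norm_nonneg (νf w)]
  have hrad := isUnitNormal_radial hf.contMDiff_self hN
  have hnunit : ∀ w, ‖padL (truncL (f w))‖ = 1 := fun w => by
    have h : ⟪padL (truncL (f w)), padL (truncL (f w))⟫ = (1 : ℝ) := by
      have := hrad.val_self w
      rwa [euclideanMetric_apply] at this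
    rw [real_inner_self_eq_norm_sq] at h
    nlinarith [norm_nonneg (padL (truncL (f w)))]
  -- first derivatives of the factors
  have hDU : ∀ p a : EuclideanSpace ℝ (Fin 6), fderiv ℝ U p a = deriv u (p 5) * a 5 :=
    fun p a => fderiv_verticalTest_apply hud p a
  have hDG : ∀ p v : EuclideanSpace ℝ (Fin 6), fderiv ℝ G p v = -G p * (⟪p - x₀, v⟫ / (2 * τ)) :=
    fun p v => helper_gaussianWeight_fderiv x₀ τ hτ p v
  have hD2U : ∀ p a : EuclideanSpace ℝ (Fin 6), iteratedFDeriv ℝ 2 U p ![a, a] =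
      deriv (deriv u) (p 5) * a 5 * a 5 := fun p a => iteratedFDeriv_two_verticalTest hu p a a
  have hD2G : ∀ p v : EuclideanSpace ℝ (Fin 6), iteratedFDeriv ℝ 2 G p ![v, v] =
      G p * (⟪p - x₀, v⟫ ^ 2 / (4 * τ ^ 2) - ‖v‖ ^ 2 / (2 * τ)) :=
    fun p v => helper_gaussianWeight_iteratedFDeriv_two x₀ τ hτ p v
  -- the product's derivatives on the diagonal
  have hDφ : ∀ p a : EuclideanSpace ℝ (Fin 6), fderiv ℝ (fun z => U z * G z) p a =
      deriv u (p 5) * a 5 * G p + U p * (-G p * (⟪p - x₀, a⟫ / (2 * τ))) := by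
    intro p a
    rw [fderiv_mul_apply_of_differentiable hU1 hG1, hDU, hDG]
  have hD2φ : ∀ p a : EuclideanSpace ℝ (Fin 6), iteratedFDeriv ℝ 2 (fun z => U z * G z) p ![a, a] =
      deriv (deriv u) (p 5) * a 5 * a 5 * G p
        + 2 * (deriv u (p 5) * a 5) * (-G p * (⟪p - x₀, a⟫ / (2 * τ)))
        + U p * (G p * (⟪p - x₀, a⟫ ^ 2 / (4 * τ ^ 2) - ‖a‖ ^ 2 / (2 * τ))) := by
    intro p a
    rw [iteratedFDeriv_two_mul_apply hU2 hG2, hD2U, hDU, hDG, hD2G]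
    ring
  -- the ambient Laplacian of the product
  have hLap : ∀ p : EuclideanSpace ℝ (Fin 6),
      ∑ j : Fin 6, iteratedFDeriv ℝ 2 (fun z => U z * G z) p
        ![EuclideanSpace.single j (1 : ℝ), EuclideanSpace.single j (1 : ℝ)] =
      deriv (deriv u) (p 5) * G p
        + 2 * deriv u (p 5) * (-G p * ((p - x₀) 5 / (2 * τ)))
        + U p * (G p * (‖p - x₀‖ ^ 2 / (4 * τ ^ 2) - 3 / τ)) := by
    intro p
    have hn : ‖p - x₀‖ ^ 2 = ∑ i, (p - x₀) i ^ 2 := EuclideanSpace.real_norm_sq_eq _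
    simp only [hD2φ, EuclideanSpace.inner_single_right, one_mul, conj_trivial, PiLp.norm_single,
      norm_one, one_pow, PiLp.single_apply]
    rw [hn, Fin.sum_univ_six, Fin.sum_univ_six]
    simp only [Fin.reduceEq, if_false, if_true]
    ring
  -- the integrand, pointwise
  have hpt : ∀ (w) (Hm S : ℝ),
      (((∑ j : Fin 6, iteratedFDeriv ℝ 2 (fun z => U z * G z) (f w)
              ![EuclideanSpace.single j (1 : ℝ), EuclideanSpace.single j (1 : ℝ)])
            - iteratedFDeriv ℝ 2 (fun z => U z * G z) (f w) ![padL (truncL (f w)), padL (truncL (f w))]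
            - 4 * fderiv ℝ (fun z => U z * G z) (f w) (padL (truncL (f w))))
          - (iteratedFDeriv ℝ 2 (fun z => U z * G z) (f w) ![νf w, νf w]
            - S * fderiv ℝ (fun z => U z * G z) (f w) (padL (truncL (f w))))
          - Hm * fderiv ℝ (fun z => U z * G z) (f w) (νf w))
        = u (f w 5) * G (f w) *
            ((‖f w - x₀‖ ^ 2 - ⟪f w - x₀, padL (truncL (f w))⟫ ^ 2 - ⟪f w - x₀, νf w⟫ ^ 2) / (4 * τ ^ 2)
              - 2 / τ
              + ((4 - S) * ⟪f w - x₀, padL (truncL (f w))⟫ + Hm * ⟪f w - x₀, νf w⟫) / (2 * τ))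
          + G (f w) * (deriv (deriv u) (f w 5) * (1 - νf w 5 ^ 2) - Hm * (deriv u (f w 5) * νf w 5))
          - (deriv u (f w 5) * G (f w) / τ) * ((f w - x₀) 5 - νf w 5 * ⟪f w - x₀, νf w⟫) := by
    intro w Hm S
    rw [hLap, hD2φ, hD2φ, hDφ, hDφ, hνunit w, hnunit w, padL_apply_last]
    have hτ0 : τ ≠ 0 := hτ.ne'
    simp only [hUdef]
    field_simp
    ring
  refine (integral_congr_ae (Eventually.of_forall fun w => ?_)).trans h0
  exact (hpt w _ _).symm

end Identity

end Summit.SmoothPoincare4.SmoothPoincare4.Cruxes.CylinderRungTwo.KillingFlux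

end
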